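import Summits.QuantumAdvantage.AdviceFreeQNC0.GradedSeeds38Targets
import Summits.QuantumAdvantage.AdviceFreeQNC0.AffBells34CoverHard

/-!
# Cell qa-qnc0, `p = 3` — GRADED seeds, part 3: `GradedJuntaReduction` PROVED, and Theorem G / the span branch of (J3) in walk coordinates
(prover qn-prover-3 g22; ROUND-37 §3.2, asks P1-38a(2)–(3) of planner qa-qnc0-p1 g38)

§5. The reduction target typed in `GradedSeeds38Targets.lean` §4,

  `GradedJuntaReduction : ∀ ρ α, 0 ≤ ρ → 3ρ^α < 1 → TwistedJuntaBoundX3 ρ → SeedJuntaHardX α`,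

is PROVED (`gradedJuntaReduction`, sorry-free): the (conjectural, OPEN) twisted junta bound transfers the cover hardness of
`W`-tolerant polylog-junta strategies (`AffBells34.coverPolylogHard`, ONE absolute `θ < 1`, tree) to ALL seed ⊕ junta strategies
`x ↦ H k (resVec c x) x` over ANY number `R` of seeds `c` graded-spread outside `W` (schedule `α(j+1) + D·⌊log₂N⌋`, `D = α(A+1)`,
`A` = the exponent of the junta bound), with constant `(1+θ)/2 < 1`.  Proof = the graded expansion
`GradedSeeds38.sum_le_max_add_graded` with weights `G_v(x) = 1[OddZeros x ∧ Rel x (H · v x)]`: main term = the frozen-residue junta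
strategy (`coverPolylogHard`); twisted term of top index `j` `≤ N^A ρ^{α(j+1)+D log₂N} 2^N` (`TwistedJuntaBoundX3`, the combination
`Σ_i γ_i c_i` has `≥ α(j+1)+D log₂N` non-zero coefficients outside `W`, `ρ ≤ 1`); error
`N^A (ρ^α)^{(A+1)log₂N} 2^N Σ_j (3ρ^α)^{j+1} ≤ (2^{A+1}/N)(3ρ^α/(1−3ρ^α)) 2^N ≤ ((1−θ)/2)·2^{N−1}` for
`N ≥ 2^{A+2}(3ρ^α/(1−3ρ^α))/((1−θ)/2)` (`(ρ^α)^{log₂N} ≤ (1/2)^{log₂N} ≤ 2/N`).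
Consequence for the (J3)_{r=1} dichotomy (ROUND-37 §3): the STRUCTURED branch (all greedy remainders polylog) is reduced, in the tree,
to the single analytic statement `TwistedJuntaBoundX3 ρ` for SOME `ρ < 1` (given `ρ < 1` pick `α` with `3ρ^α < 1`).

§6. `ringGradedSeedsSharp3_walk`, `perOutputForms_span_walk`: Theorem G and its span corollary transported to WALK coordinates — the
frame of (J3) `BlockFibre37.PerOutputFormsHardConst` (`BlockCombJoin37.lean`; gate sums `BlockFibre37.gateSum` written out, bridge =
`rfl`) — at the ring charge `n + 2`: `#{u : Fin n → Bool | the walk strategy wins} ≤ (2/3 + ε)·2ⁿ` whenever the private forms of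
every output lie in the span of one graded-spread seed sequence (transport `card_odd_filter_ge` + `rel_iff_ringWinU`).

WHAT THIS IS NOT: `TwistedJuntaBoundX3` is NOT proved here (conditional reduction only); charge `n + 2` only in §6; the residual
core (heavy greedy remainders, ROUND-37 §4) and crux stmt-QuantumAdvantage-22907 are untouched; no ledger item (D-0168 shelf).
-/

noncomputable section

namespace Summit.QuantumAdvantage.AdviceFreeQNC0

open Finset Literature.Computability.QuantumComplexity Literature.Computability.MetaComplexity

namespace GradedSeeds38

/-! ## §5 `GradedJuntaReduction` (ROUND-37 §3.2 recipe, ask P1-38a(2)) -/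

section Reduction

/-- The graded error series for a ratio `q ∈ [0,1)`: `Σ_{j<R} q^{j+1} ≤ q/(1−q)` for every `R`. -/
theorem sum_pow_succ_le_div (q : ℝ) (hq0 : 0 ≤ q) (hq1 : q < 1) (R : ℕ) :
    ∑ j : Fin R, q ^ (j.val + 1) ≤ q / (1 - q) := by
  have h1 : ∑ j : Fin R, q ^ (j.val + 1) = ∑ i ∈ Ico 1 (R + 1), q ^ i := by
    rw [Finset.sum_Ico_eq_sum_range, Fin.sum_univ_eq_sum_range (fun n => q ^ (n + 1)) R]
    simp only [Nat.add_sub_cancel]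
    exact sum_congr rfl fun k _ => by rw [add_comm]
  rw [h1]
  refine (geom_sum_Ico_le_of_lt_one hq0 hq1).trans ?_
  rw [pow_one]

/-- `(1/2)^{⌊log₂ N⌋} ≤ 2/N` (from `N < 2^{⌊log₂ N⌋ + 1}`). -/
theorem half_pow_log_le (N : ℕ) (hN : 0 < N) : (1 / 2 : ℝ) ^ (Nat.log 2 N) ≤ 2 / N := by
  have h : N < 2 ^ (Nat.log 2 N + 1) := Nat.lt_pow_succ_log_self (by norm_num) N
  have h' : (N : ℝ) < (2 : ℝ) ^ (Nat.log 2 N + 1) := by exact_mod_cast h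
  rw [pow_succ] at h'
  have hpos : (0 : ℝ) < (2 : ℝ) ^ Nat.log 2 N := by positivity
  have hNpos : (0 : ℝ) < N := by exact_mod_cast hN
  rw [one_div_pow, div_le_div_iff₀ hpos hNpos]
  linarith

/-- The polynomial-vs-polylog-power bookkeeping: `N^A · (ρ^α)^{(A+1)·⌊log₂N⌋} ≤ 2^{A+1}/N` when `ρ^α ≤ 1/2`. -/
theorem pow_mul_decay_le (N A : ℕ) (hN : 0 < N) (t : ℝ) (ht0 : 0 ≤ t) (ht : t ≤ 1 / 2) :
    (N : ℝ) ^ A * t ^ ((A + 1) * Nat.log 2 N) ≤ (2 : ℝ) ^ (A + 1) / N := by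
  have hNpos : (0 : ℝ) < N := by exact_mod_cast hN
  have h1 : t ^ ((A + 1) * Nat.log 2 N) ≤ ((2 : ℝ) / N) ^ (A + 1) := by
    rw [mul_comm, pow_mul]
    refine pow_le_pow_left₀ (by positivity) ?_ (A + 1)
    exact (pow_le_pow_left₀ ht0 ht _).trans (half_pow_log_le N hN)
  calc (N : ℝ) ^ A * t ^ ((A + 1) * Nat.log 2 N)
      ≤ (N : ℝ) ^ A * ((2 : ℝ) / N) ^ (A + 1) := by gcongr
    _ = (2 : ℝ) ^ (A + 1) / N := by
        rw [div_pow, pow_succ (N : ℝ) A]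
        field_simp

open scoped Classical in
/-- **`gradedJuntaReduction : GradedJuntaReduction` — PROVED** (ROUND-37 §3.2; ask P1-38a(2)).  For `0 ≤ ρ`, `3ρ^α < 1`, the
twisted junta bound `TwistedJuntaBoundX3 ρ` transfers the cover hardness of `W`-tolerant polylog-junta strategies
(`AffBells34.coverPolylogHard`, one absolute `θ < 1`) to ALL seed ⊕ junta strategies over ANY number `R` of seeds that are
graded-spread outside `W` with schedule `α(j+1) + α(A+1)·⌊log₂N⌋` (`A` = the exponent of the junta bound at junta size
`(log₂N)^C`), with constant `(1+θ)/2`.  Proof = the proof of `ringGradedSeedsSharp3` with main term `coverPolylogHard` (frozen seed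
residues `v` give a junta strategy `x ↦ H k v x`) and graded error `Σ_j 3^{j+1}·N^A ρ^{α(j+1)+α(A+1)log₂N}·2^N
≤ (3ρ^α/(1−3ρ^α))·(2^{A+1}/N)·2^N = o(2^{N−1})` via `(ρ^α)^{(A+1)log₂N} ≤ (2/N)^{A+1}`. -/
theorem gradedJuntaReduction : GradedJuntaReduction := by
  classical
  intro ρ α hρ hq hTJ
  obtain ⟨θ, hθ, hcover⟩ := AffBells34.coverPolylogHard
  refine ⟨(1 + θ) / 2, by linarith, fun C => ?_⟩
  obtain ⟨n₁, hn₁⟩ := hcover C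
  obtain ⟨A, n₂, hn₂⟩ := hTJ C
  -- the ratio `q = 3ρ^α ∈ [0,1)` and `ρ^α ≤ 1/2`, `ρ ≤ 1`
  have hρα0 : 0 ≤ ρ ^ α := pow_nonneg hρ α
  have hq0 : 0 ≤ 3 * ρ ^ α := by positivity
  have hρα : ρ ^ α ≤ 1 / 2 := by linarith
  have hρ1 : ρ ≤ 1 := by
    by_contra h
    have h1 : 1 ≤ ρ ^ α := one_le_pow₀ (le_of_lt (not_le.1 h))
    linarith
  have h1θ : 0 < (1 - θ) / 2 := by linarith
  -- the error constant
  obtain ⟨n₃, hn₃⟩ : ∃ n₃ : ℕ, (2 : ℝ) ^ (A + 2) * (3 * ρ ^ α / (1 - 3 * ρ ^ α)) / ((1 - θ) / 2) ≤ n₃ :=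
    ⟨_, Nat.le_ceil _⟩
  refine ⟨α * (A + 1), max (max n₁ n₂) (max n₃ 1), fun N hN W R c T H hW hspread hT hH => ?_⟩
  have hN1 : n₁ ≤ N := le_trans (le_trans (le_max_left _ _) (le_max_left _ _)) hN
  have hN2 : n₂ ≤ N := le_trans (le_trans (le_max_right _ _) (le_max_left _ _)) hN
  have hN3 : n₃ ≤ N := le_trans (le_trans (le_max_left _ _) (le_max_right _ _)) hN
  have hNone : 1 ≤ N := le_trans (le_trans (le_max_right _ _) (le_max_right _ _)) hN
  have hNpos : (0 : ℝ) < N := by exact_mod_cast hNone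
  set L : ℕ := Nat.log 2 N with hL
  set P : (Fin R → ZMod 3) → (Fin N → Bool) → Prop := fun v x =>
    OddZeros x ∧ RingHLF.Rel x (fun k => H k v x) with hP
  set Bj : Fin R → ℝ := fun j => (N : ℝ) ^ A * ρ ^ (α * (j.val + 1) + α * (A + 1) * L) * (2 : ℝ) ^ N with hBj
  have hBj0 : ∀ j, 0 ≤ Bj j := fun j => by positivity
  -- (a) main term: frozen seed residues give a `W`-tolerant polylog-junta strategy (`coverPolylogHard`)
  have ha : ∀ v : Fin R → ZMod 3,
      ∑ x : Fin N → Bool, (if P v x then (1 : ℝ) else 0) ≤ θ * (2 : ℝ) ^ (N - 1) := by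
    intro v
    have h := hn₁ N hN1 W T (fun k x => H k v x) hW hT (fun k => fun x x' hxx' => hH k v x x' hxx')
    rw [sum_boole]
    simpa [AffBells22.winCount, hP] using h
  -- (b) graded twisted sums: `TwistedJuntaBoundX3`
  have hb : ∀ (v γ : Fin R → ZMod 3) (j : Fin R), IsTop γ j →
      ‖∑ x : Fin N → Bool, (ZMod.stdAddChar (∑ i, γ i * LinForms.resVec c x i) : ℂ) *
          ((if P v x then (1 : ℝ) else 0 : ℝ) : ℂ)‖ ≤ Bj j := by
    intro v γ j hj
    set β : Fin N → ZMod 3 := fun m => ∑ i, γ i * c i m with hβ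
    have hres : ∀ x : Fin N → Bool, ∑ i, γ i * LinForms.resVec c x i = ∑ m, if x m then β m else 0 := by
      intro x
      simp only [LinForms.resVec, hβ, mul_sum]
      rw [sum_comm]
      refine sum_congr rfl fun m _ => ?_
      split_ifs <;> simp
    have h := hn₂ N hN2 W T (fun k x => H k v x) hW hT (fun k x x' hxx' => hH k v x x' hxx') β
    have hcast : ∀ x : Fin N → Bool, (((if P v x then (1 : ℝ) else 0 : ℝ)) : ℂ) = (if P v x then (1 : ℂ) else 0) := by
      intro x; split_ifs <;> simp
    simp_rw [hres, hcast]
    refine le_trans (by simpa [hP] using h) ?_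
    have hw : α * (j.val + 1) + α * (A + 1) * L ≤ (univ.filter fun i : Fin N => i ∉ W ∧ β i ≠ 0).card :=
      hspread γ j hj
    calc (N : ℝ) ^ A * ρ ^ (univ.filter fun i : Fin N => i ∉ W ∧ β i ≠ 0).card * (2 : ℝ) ^ N
        ≤ (N : ℝ) ^ A * ρ ^ (α * (j.val + 1) + α * (A + 1) * L) * (2 : ℝ) ^ N := by
          gcongr _ * ?_ * _
          exact pow_le_pow_of_le_one hρ hρ1 hw
      _ = Bj j := rfl
  -- the graded expansion
  have hmain := sum_le_max_add_graded (p := 3) (fun x : Fin N → Bool => LinForms.resVec c x)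
    (fun v x => if P v x then (1 : ℝ) else 0) (θ * (2 : ℝ) ^ (N - 1)) Bj hBj0 ha hb
  have hset : ((univ.filter fun x : Fin N → Bool =>
      OddZeros x ∧ RingHLF.Rel x (fun k => H k (LinForms.resVec c x) x)).card : ℝ)
      = ∑ x : Fin N → Bool, (if P (LinForms.resVec c x) x then (1 : ℝ) else 0) := by
    rw [sum_boole]
  rw [hset]
  refine hmain.trans ?_
  -- (c) the error term `Σ_j 3^{j+1} Bj j ≤ ((1-θ)/2)·2^{N-1}`
  have herr : ∑ j : Fin R, ((3 : ℕ) : ℝ) ^ (j.val + 1) * Bj j ≤ ((1 - θ) / 2) * (2 : ℝ) ^ (N - 1) := by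
    have hterm : ∀ j : Fin R, ((3 : ℕ) : ℝ) ^ (j.val + 1) * Bj j =
        (3 * ρ ^ α) ^ (j.val + 1) * ((N : ℝ) ^ A * (ρ ^ α) ^ ((A + 1) * L) * (2 : ℝ) ^ N) := by
      intro j
      have e1 : ρ ^ (α * (j.val + 1) + α * (A + 1) * L) = (ρ ^ α) ^ (j.val + 1) * (ρ ^ α) ^ ((A + 1) * L) := by
        rw [pow_add, pow_mul, mul_assoc, pow_mul]
      have eB : Bj j = (N : ℝ) ^ A * ρ ^ (α * (j.val + 1) + α * (A + 1) * L) * (2 : ℝ) ^ N := rfl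
      rw [eB, e1, mul_pow]; push_cast; ring
    rw [sum_congr rfl fun j _ => hterm j, ← sum_mul]
    have hN2 : (2 : ℝ) ^ N = 2 * (2 : ℝ) ^ (N - 1) := by
      rw [← pow_succ']; congr 1; omega
    have hgeo := sum_pow_succ_le_div (3 * ρ ^ α) hq0 hq R
    have hdec := pow_mul_decay_le N A hNone (ρ ^ α) hρα0 hρα
    have hq1 : 0 < 1 - 3 * ρ ^ α := by linarith
    have hK0 : 0 ≤ 3 * ρ ^ α / (1 - 3 * ρ ^ α) := div_nonneg hq0 hq1.le
    have hp : (0 : ℝ) ≤ (2 : ℝ) ^ (N - 1) := by positivity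
    -- `N ≥ n₃` gives `2^{A+2} · (q/(1-q)) / N ≤ (1-θ)/2`
    have hN3' : (2 : ℝ) ^ (A + 2) * (3 * ρ ^ α / (1 - 3 * ρ ^ α)) / ((1 - θ) / 2) ≤ N :=
      hn₃.trans (by exact_mod_cast hN3)
    have hkey : (2 : ℝ) ^ (A + 2) * (3 * ρ ^ α / (1 - 3 * ρ ^ α)) / N ≤ (1 - θ) / 2 := by
      rw [div_le_iff₀ hNpos]
      rw [div_le_iff₀ h1θ] at hN3'
      linarith
    calc (∑ j : Fin R, (3 * ρ ^ α) ^ (j.val + 1)) * ((N : ℝ) ^ A * (ρ ^ α) ^ ((A + 1) * L) * (2 : ℝ) ^ N)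
        ≤ (3 * ρ ^ α / (1 - 3 * ρ ^ α)) * ((2 : ℝ) ^ (A + 1) / N * (2 : ℝ) ^ N) := by
          refine mul_le_mul hgeo ?_ (by positivity) hK0
          exact mul_le_mul_of_nonneg_right hdec (by positivity)
      _ = ((2 : ℝ) ^ (A + 2) * (3 * ρ ^ α / (1 - 3 * ρ ^ α)) / N) * (2 : ℝ) ^ (N - 1) := by
          rw [hN2]; ring
      _ ≤ ((1 - θ) / 2) * (2 : ℝ) ^ (N - 1) := mul_le_mul_of_nonneg_right hkey hp
  have h3 : ∑ j : Fin R, ((3 : ℕ) : ℝ) ^ (j.val + 1) * Bj j = ∑ j : Fin R, (3 : ℝ) ^ (j.val + 1) * Bj j := by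
    push_cast; rfl
  linarith [herr]

end Reduction

/-! ## §6 Theorem G and the span branch of (J3) in WALK coordinates (ask P1-38a(3); next to `BlockFibre37.PerOutputFormsHardConst`) -/

section Walk

/-- Transfer of counts through the chart, lower direction: `#{u : Q u} ≤ #{x odd : Q (uVec x)}` (from
`card_odd_filter_ge`: the odd class has `≥ 2ⁿ` patterns and `uVec` is injective on it). -/
theorem card_filter_le_card_odd {n : ℕ} (hn : 2 ≤ n) (Q : (Fin n → Bool) → Prop) [DecidablePred Q] :
    ((univ : Finset (Fin n → Bool)).filter Q).card ≤
      (univ.filter fun x : Fin (n + 1) → Bool =>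
        (univ.filter fun j : Fin (n + 1) => x j = false).card % 2 = 1 ∧ Q (uVec x)).card := by
  have h := card_odd_filter_ge hn Q
  have htot := Finset.card_filter_add_card_filter_not (s := (univ : Finset (Fin n → Bool))) Q
  rw [card_univ, Fintype.card_fun, Fintype.card_bool, Fintype.card_fin] at htot
  omega

open scoped Classical in
/-- **Theorem G in WALK coordinates** (the frame of `BlockFibre37.PerOutputFormsHardConst`, (J3)): for `n ≥ n₀`, every `R`, every
graded-spread seed sequence `c : Fin R → (Fin (n+1) → ℤ/3)` (schedule `8(j+1) + w₀`) and every branch table `tab`, the walk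
strategy whose `g`-th output is `tab g` applied to the `R` gate values `Σ_m [xOfU u m]·c_i m` (= `BlockFibre37.gateSum (c i) u`,
unfolded) WINS the walk game at the ring charge `n + 2` on at most `(2/3 + ε)·2ⁿ` inputs `u`.  Transport of
`ringGradedSeedsSharp3`: `#{u : WIN} ≤ #{x odd : WIN (uVec x)}` (`card_filter_le_card_odd`) and `rel_iff_ringWinU` (the
x-strategy `tGuess ⊕ tab(resVec c x)` transports to exactly this walk strategy, `xOfU (uVec x) = x`).  Charge `n + 2` only. -/
theorem ringGradedSeedsSharp3_walk : ∀ ε : ℝ, 0 < ε → ∃ w₀ n₀ : ℕ, ∀ n ≥ n₀, ∀ (R : ℕ) (c : Fin R → Fin (n + 1) → ZMod 3),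
    GradedSpread c (fun j => 8 * (j.val + 1) + w₀) →
    ∀ tab : Fin (n + 1) → (Fin R → ZMod 3) → Bool,
      ((univ.filter fun u : Fin n → Bool =>
          ringWinU (n + 2) (fun g u => tab g (fun i => ∑ m : Fin (n + 1), if xOfU u m = true then c i m else 0)) u
            = true).card : ℝ) ≤ (2 / 3 + ε) * (2 : ℝ) ^ n := by
  classical
  intro ε hε
  obtain ⟨w₀, n₀, h⟩ := ringGradedSeedsSharp3 ε hε
  refine ⟨w₀, max n₀ 2, fun n hn R c hc tab => ?_⟩
  have hn₀ : n₀ ≤ n + 1 := by have := le_max_left n₀ 2; omega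
  have hn2 : 2 ≤ n := le_trans (le_max_right _ _) hn
  -- the x-frame strategy and its transported walk strategy
  set z : (Fin (n + 1) → Bool) → (Fin (n + 1) → Bool) :=
    fun x k => xor (tGuess x k) (tab k (LinForms.resVec c x)) with hz
  have hx := h (n + 1) hn₀ R c hc tab
  rw [Nat.add_sub_cancel] at hx
  set y : Fin (n + 1) → (Fin n → Bool) → Bool :=
    fun g u => tab g (fun i => ∑ m : Fin (n + 1), if xOfU u m = true then c i m else 0) with hy
  have hy' : (fun (g : Fin (n + 1)) (u : Fin n → Bool) => xor (z (xOfU u) g) (tGuess (xOfU u) g)) = y := by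
    funext g u
    have e : LinForms.resVec c (xOfU u) = fun i => ∑ m : Fin (n + 1), if xOfU u m = true then c i m else 0 := rfl
    simp only [hz, hy, e]
    generalize tGuess (xOfU u) g = t
    generalize tab g (fun i => ∑ m : Fin (n + 1), if xOfU u m = true then c i m else 0) = d
    cases t <;> cases d <;> rfl
  -- count transfer through the chart
  have h1 := card_filter_le_card_odd hn2 (fun u : Fin n → Bool => ringWinU (n + 2) y u = true)
  have h2 : (univ.filter fun x : Fin (n + 1) → Bool =>
        (univ.filter fun j : Fin (n + 1) => x j = false).card % 2 = 1 ∧ ringWinU (n + 2) y (uVec x) = true)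
      ⊆ univ.filter fun x : Fin (n + 1) → Bool => OddZeros x ∧ RingHLF.Rel x (z x) := by
    intro x hx'
    rw [mem_filter] at hx' ⊢
    refine ⟨mem_univ _, hx'.2.1, ?_⟩
    rw [rel_iff_ringWinU hn2 x hx'.2.1 z, hy']
    exact hx'.2.2
  have h3 := h1.trans (Finset.card_le_card h2)
  calc ((univ.filter fun u : Fin n → Bool => ringWinU (n + 2) y u = true).card : ℝ)
      ≤ ((univ.filter fun x : Fin (n + 1) → Bool => OddZeros x ∧ RingHLF.Rel x (z x)).card : ℝ) := by
        exact_mod_cast h3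
    _ ≤ (2 / 3 + ε) * (2 : ℝ) ^ n := hx

open scoped Classical in
/-- **The span branch of (J3) in WALK coordinates**: if the `r` private forms of every output `g` are combinations
`Σ_t a g i t • s t` of ONE graded-spread seed sequence `s` (any length `R`), then the (J3)-strategy
`u ↦ (F g (gateSum (ℓ g i) u))_g` — `BlockFibre37.PerOutputFormsHardConst`'s class with `ℓ g i = Σ_t a g i t • s t`, gate sums
unfolded — wins at the ring charge `n + 2` on `≤ (2/3 + ε)·2ⁿ` inputs: the SHARP constant, versus the `θ < 1` that (J3) asks for
arbitrary private forms.  (Re-tabulate `ringGradedSeedsSharp3_walk`.) -/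
theorem perOutputForms_span_walk : ∀ ε : ℝ, 0 < ε → ∃ w₀ n₀ : ℕ, ∀ n ≥ n₀, ∀ (R : ℕ) (s : Fin R → Fin (n + 1) → ZMod 3),
    GradedSpread s (fun j => 8 * (j.val + 1) + w₀) →
    ∀ (r : ℕ) (a : Fin (n + 1) → Fin r → Fin R → ZMod 3) (F : Fin (n + 1) → (Fin r → ZMod 3) → Bool),
      ((univ.filter fun u : Fin n → Bool =>
          ringWinU (n + 2) (fun g u => F g (fun i => ∑ m : Fin (n + 1),
            if xOfU u m = true then (∑ t, a g i t * s t m) else 0)) u = true).card : ℝ)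
        ≤ (2 / 3 + ε) * (2 : ℝ) ^ n := by
  classical
  intro ε hε
  obtain ⟨w₀, n₀, h⟩ := ringGradedSeedsSharp3_walk ε hε
  refine ⟨w₀, n₀, fun n hn R s hs r a F => ?_⟩
  have key := h n hn R s hs (fun g v => F g (fun i => ∑ t, a g i t * v t))
  have hsum : ∀ (u : Fin n → Bool) (g : Fin (n + 1)) (i : Fin r),
      (∑ m : Fin (n + 1), if xOfU u m = true then (∑ t, a g i t * s t m) else 0)
        = ∑ t, a g i t * ∑ m : Fin (n + 1), if xOfU u m = true then s t m else 0 := by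
    intro u g i
    simp_rw [Finset.mul_sum]
    rw [Finset.sum_comm]
    refine sum_congr rfl fun m _ => ?_
    split_ifs <;> simp
  simp_rw [hsum]
  exact key

end Walk

end GradedSeeds38

end Summit.QuantumAdvantage.AdviceFreeQNC0

end
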